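import Summits.Ventures.CertifiedQuantumChemistry.Rows.HubbardRingTVWeakCoupling
import HarnessLib

/-!
# Ventures/CertifiedQuantumChemistry — Rows/HubbardRingTVWeakCouplingLimit.lean: the WEAK-COUPLING LIMIT
# of the certified gaps — `E₀ − OPT_X → 0` and `ĉ_X(2n; U) = (U/4)(E₀ − OPT_X) → 0` as `U → 0⁺`

HONEST FRAMING (verbatim): certified bounds for a stated model Hamiltonian in a stated basis; not a
claim about the real molecule beyond that model.

Seat rdm-B, ROWS courtesy file (theorems only; no `def`, no notation, no instance; zero compute). The
conjecture leaf `Rows/ConjectureSU.lean` is about the STRONG-coupling limit of the scaled gap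
`ĉ_X(2n; U) = (U/4)·(E₀(2n; 1, U; n, n) − OPT_X(2n; 1, U))` along `U → ∞` in `ℚ` (open). Its
WEAK-coupling end is elementary and is typed here from the envelope of
`Rows/HubbardRingTVWeakCoupling.lean` (`0 ≤ E₀ − OPT_X ≤ U·min(N_α, N_β)` for `U ≥ 0`,
`0 ≤ ĉ_X(2n; U) ≤ n·U²/4` for `U > 0`), by squeezing along the filters `𝓝[≥] 0` / `𝓝[>] 0` of `ℚ`:

* `tendsto_hubbardRingTV_gap_sector_zero` / `…_singlet_zero` — for every `t` and `a, b ≤ L`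
  (resp. `L = 2n`, `n ≥ 1`) the certified gap `E₀ − OPT_DQG` (resp. `E₀(n, n) − OPT_DQG+S²`) of
  `hubbardRingTV L t U` tends to `0` as `U → 0` from above (it IS `0` at `U = 0`);
* **`tendsto_scaledGap_sector_zero`** / **`tendsto_scaledGap_singlet_zero`** — in the leaf's own spelling,
  `ĉ_DQG(2n; U) → 0` and `ĉ_DQG+S²(2n; U) → 0` as `U → 0⁺` along `ℚ` (`n ≥ 1`): the scaled gap, whose
  `U → ∞` limit S-U conjectures to exist and to be `c_X(2n) ≥ 0`, starts from `0` at the free-fermion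
  end.

* §2 `hubbardRingTV_gap_sector_le_uniform` / `…_singlet_…` — a bound UNIFORM in `U`: at half filling
  `E₀ − OPT_X ≤ 4√2·|t|·n` for every `t`, `U ≥ 0` (geometric mean of the weak envelope `U·n` and gen
  36's strong envelope `32t²n/U`).

Nothing is claimed about `U → ∞`, about monotonicity, or about any value in between. All PROVED
(0 sorry, standard axioms); no definitions, no named facts. Tree (REUSED): `hubbardRingTV_gap_sector_mem_Icc`,
`hubbardRingTV_gap_singlet_mem_Icc`, `scaledGap_sector_le_weak`, `scaledGap_singlet_le_weak`,
`StrongCouplingGap.scaledGap_{sector,singlet}_mem_Icc` (gen 36/38). Mathlib: `Rat.continuous_coe_real`,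
`tendsto_of_tendsto_of_tendsto_of_le_of_le'`, `eventually_nhdsWithin_of_forall`, `tendsto_nhdsWithin_of_tendsto_nhds`.
-/

noncomputable section

namespace Summit.Ventures.CertifiedQuantumChemistry

open Filter
open Literature.MathematicalPhysics.QuantumLattice Literature.MathematicalPhysics.QuantumChemistry
open Summit.Ventures.CertifiedQuantumChemistry.Hamiltonians
open scoped Topology

section WeakLimit

variable {L : ℕ}

/-- The envelope `U ↦ U·m` tends to `0` as `U → 0` within any set (cast `ℚ → ℝ`). -/
theorem tendsto_ratCast_mul_const_zero (m : ℝ) (s : Set ℚ) :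
    Tendsto (fun U : ℚ => (U : ℝ) * m) (𝓝[s] 0) (𝓝 0) := by
  have h : Tendsto (fun U : ℚ => (U : ℝ) * m) (𝓝 0) (𝓝 ((((0 : ℚ) : ℝ)) * m)) :=
    (Rat.continuous_coe_real.tendsto 0).mul_const m
  rw [Rat.cast_zero, zero_mul] at h
  exact tendsto_nhdsWithin_of_tendsto_nhds h

/-- The envelope `U ↦ n·U²/4` tends to `0` as `U → 0` within any set. -/
theorem tendsto_sq_envelope_zero (n : ℝ) (s : Set ℚ) :
    Tendsto (fun U : ℚ => n * (U : ℝ) ^ 2 / 4) (𝓝[s] 0) (𝓝 0) := by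
  have h : Tendsto (fun U : ℚ => n * (U : ℝ) ^ 2 / 4) (𝓝 0) (𝓝 (n * ((0 : ℚ) : ℝ) ^ 2 / 4)) :=
    (((Rat.continuous_coe_real.tendsto 0).pow 2).const_mul n).div_const 4
  rw [Rat.cast_zero, zero_pow two_ne_zero, mul_zero, zero_div] at h
  exact tendsto_nhdsWithin_of_tendsto_nhds h

/-- **THE SECTOR GAP VANISHES AT WEAK COUPLING**: for every `t` and `a, b ≤ L`,
`E₀(hubbardRingTV L t U; a, b) − OPT_DQG(hubbardRingTV L t U; a, b) → 0` as `U → 0` from above in `ℚ`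
(squeezed between `0` and `U·min(a, b)`). [folklore] -/
theorem tendsto_hubbardRingTV_gap_sector_zero (t : ℚ) {a b : ℕ} (ha : a ≤ L) (hb : b ≤ L) :
    Tendsto (fun U : ℚ => Model.energy (hubbardRingTV L t U) a b - Model.pqgSectorEnergy (hubbardRingTV L t U) a b)
      (𝓝[Set.Ici 0] 0) (𝓝 0) := by
  refine tendsto_of_tendsto_of_tendsto_of_le_of_le' tendsto_const_nhds
    (tendsto_ratCast_mul_const_zero (min (a : ℝ) (b : ℝ)) (Set.Ici 0)) ?_ ?_
  · exact eventually_nhdsWithin_of_forall fun U hU => (hubbardRingTV_gap_sector_mem_Icc t hU ha hb).1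
  · exact eventually_nhdsWithin_of_forall fun U hU => (hubbardRingTV_gap_sector_mem_Icc t hU ha hb).2

/-- **THE SINGLET GAP VANISHES AT WEAK COUPLING**: `E₀(2n; t, U; n, n) − OPT_DQG+S²(2n; t, U; n) → 0` as
`U → 0` from above in `ℚ` (`n ≥ 1`, every `t`). [folklore] -/
theorem tendsto_hubbardRingTV_gap_singlet_zero {n : ℕ} (hn : 1 ≤ n) (t : ℚ) :
    Tendsto (fun U : ℚ => Model.energy (hubbardRingTV (2 * n) t U) n n -
        Model.pqgSingletEnergy (hubbardRingTV (2 * n) t U) n) (𝓝[Set.Ici 0] 0) (𝓝 0) := by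
  refine tendsto_of_tendsto_of_tendsto_of_le_of_le' tendsto_const_nhds
    (tendsto_ratCast_mul_const_zero (n : ℝ) (Set.Ici 0)) ?_ ?_
  · exact eventually_nhdsWithin_of_forall fun U hU => (hubbardRingTV_gap_singlet_mem_Icc hn t hU).1
  · exact eventually_nhdsWithin_of_forall fun U hU => (hubbardRingTV_gap_singlet_mem_Icc hn t hU).2

/-- **THE SCALED GAP OF THE CONJECTURE LEAF VANISHES AT THE WEAK-COUPLING END, SECTOR LEVEL**:
`ĉ_DQG(2n; U) = (U/4)·(E₀(2n; 1, U; n, n) − OPT_DQG(2n; 1, U; n, n)) → 0` as `U → 0⁺` along `ℚ` (`n ≥ 1`;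
the `U → ∞` limit is what `ConjectureSU_DQG` is about — untouched). [folklore] -/
theorem tendsto_scaledGap_sector_zero {n : ℕ} (hn : 1 ≤ n) :
    Tendsto (fun U : ℚ => ((U : ℝ) / 4) *
        (Model.energy (hubbardRingTV (2 * n) 1 U) n n - Model.pqgSectorEnergy (hubbardRingTV (2 * n) 1 U) n n))
      (𝓝[Set.Ioi 0] 0) (𝓝 0) := by
  refine tendsto_of_tendsto_of_tendsto_of_le_of_le' tendsto_const_nhds
    (tendsto_sq_envelope_zero (n : ℝ) (Set.Ioi 0)) ?_ ?_
  · exact eventually_nhdsWithin_of_forall fun U hU => (StrongCouplingGap.scaledGap_sector_mem_Icc hn hU).1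
  · exact eventually_nhdsWithin_of_forall fun U hU => scaledGap_sector_le_weak hn hU

/-- **… SINGLET LEVEL**: `ĉ_DQG+S²(2n; U) = (U/4)·(E₀(2n; 1, U; n, n) − OPT_DQG+S²(2n; 1, U; n)) → 0` as
`U → 0⁺` along `ℚ` (`n ≥ 1`; `ConjectureSU_DQGS2` concerns `U → ∞` — untouched). [folklore] -/
theorem tendsto_scaledGap_singlet_zero {n : ℕ} (hn : 1 ≤ n) :
    Tendsto (fun U : ℚ => ((U : ℝ) / 4) *
        (Model.energy (hubbardRingTV (2 * n) 1 U) n n - Model.pqgSingletEnergy (hubbardRingTV (2 * n) 1 U) n))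
      (𝓝[Set.Ioi 0] 0) (𝓝 0) := by
  refine tendsto_of_tendsto_of_tendsto_of_le_of_le' tendsto_const_nhds
    (tendsto_sq_envelope_zero (n : ℝ) (Set.Ioi 0)) ?_ ?_
  · exact eventually_nhdsWithin_of_forall fun U hU => (StrongCouplingGap.scaledGap_singlet_mem_Icc hn hU).1
  · exact eventually_nhdsWithin_of_forall fun U hU => scaledGap_singlet_le_weak hn hU

end WeakLimit

/-! ## §2 A bound UNIFORM in `U`: the certified gap never exceeds `4√2·|t|·n` at half filling -/

section Uniform

/-- The geometric-mean step: `0 ≤ g ≤ A`, `g ≤ B`, `A·B ≤ C²`, `C ≥ 0` ⇒ `g ≤ C`. [folklore] -/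
theorem le_of_le_of_le_of_mul_le_sq {g A B C : ℝ} (hg0 : 0 ≤ g) (hA : g ≤ A) (hB : g ≤ B) (hC : 0 ≤ C)
    (hAB : A * B ≤ C ^ 2) : g ≤ C := by
  have hgg : g * g ≤ C ^ 2 := (mul_le_mul hA hB hg0 (hg0.trans hA)).trans hAB
  by_contra h
  have h' : C < g := lt_of_not_ge h
  nlinarith [mul_pos (sub_pos.2 h') (add_pos_of_pos_of_nonneg (lt_of_le_of_lt hC h') hC)]

/-- **THE CERTIFIED SECTOR GAP IS UNIFORMLY BOUNDED IN `U`**: on the half-filled even ring (`L = 2n`,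
`n ≥ 1`), for every `t` and every `U ≥ 0`,
`E₀(hubbardRingTV (2n) t U; n, n) − OPT_DQG(hubbardRingTV (2n) t U; n, n) ≤ 4√2·|t|·n` — the geometric
mean of the weak-coupling envelope `U·n` (`Rows/HubbardRingTVWeakCoupling.lean`) and gen 36's
strong-coupling envelope `32t²n/U` (`E₀ ≤ 0`, `OPT_DQG ≥ −16t²L/U`). [folklore] -/
theorem hubbardRingTV_gap_sector_le_uniform {n : ℕ} (hn : 1 ≤ n) (t : ℚ) {U : ℚ} (hU : 0 ≤ U) :
    Model.energy (hubbardRingTV (2 * n) t U) n n - Model.pqgSectorEnergy (hubbardRingTV (2 * n) t U) n n ≤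
      4 * Real.sqrt 2 * |(t : ℝ)| * n := by
  have hnL : n ≤ 2 * n := by omega
  have hC : 0 ≤ 4 * Real.sqrt 2 * |(t : ℝ)| * n := by positivity
  obtain ⟨hg0, hg1⟩ := hubbardRingTV_gap_sector_mem_Icc (L := 2 * n) t hU hnL hnL
  rw [min_self] at hg1
  rcases hU.eq_or_lt with h0 | hpos
  · have hz : (U : ℝ) * (n : ℝ) = 0 := by rw [← h0, Rat.cast_zero, zero_mul]
    linarith
  · have hU' : (0 : ℝ) < (U : ℝ) := by exact_mod_cast hpos
    have hE : Model.energy (hubbardRingTV (2 * n) t U) n n ≤ 0 :=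
      StrongCouplingDoublon.hubbardRingTV_sectorGroundEnergy_le_zero t U (by omega : n + n = 2 * n)
    have hP : -(16 * (t : ℝ) ^ 2 * ((2 * n : ℕ) : ℝ) / U) ≤ Model.pqgSectorEnergy (hubbardRingTV (2 * n) t U) n n :=
      StrongCouplingGap.hubbardRingTV_pqgSectorEnergy_ge_linear (by omega) t hpos (by omega : n + n = 2 * n)
    have h32 : 16 * (t : ℝ) ^ 2 * ((2 * n : ℕ) : ℝ) / U = 32 * (t : ℝ) ^ 2 * n / U := by push_cast; ring
    rw [h32] at hP
    refine le_of_le_of_le_of_mul_le_sq hg0 hg1 (B := 32 * (t : ℝ) ^ 2 * n / U) (by linarith) hC (le_of_eq ?_)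
    rw [show (4 * Real.sqrt 2 * |(t : ℝ)| * n) ^ 2 = 16 * (Real.sqrt 2) ^ 2 * |(t : ℝ)| ^ 2 * (n : ℝ) ^ 2 by ring,
      Real.sq_sqrt (by norm_num : (0 : ℝ) ≤ 2), sq_abs]
    field_simp
    ring

/-- **… and the singlet-restricted gap too**: `E₀(n, n) − OPT_DQG+S² ≤ 4√2·|t|·n` for every `t`, `U ≥ 0`
(`OPT_DQG+S² ≥ OPT_DQG`). [folklore] -/
theorem hubbardRingTV_gap_singlet_le_uniform {n : ℕ} (hn : 1 ≤ n) (t : ℚ) {U : ℚ} (hU : 0 ≤ U) :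
    Model.energy (hubbardRingTV (2 * n) t U) n n - Model.pqgSingletEnergy (hubbardRingTV (2 * n) t U) n ≤
      4 * Real.sqrt 2 * |(t : ℝ)| * n := by
  have hnk : n ≤ Fintype.card (Fin (2 * n)) := by rw [Fintype.card_fin]; omega
  have h3 : Model.pqgSectorEnergy (hubbardRingTV (2 * n) t U) n n ≤
      Model.pqgSingletEnergy (hubbardRingTV (2 * n) t U) n := pqgSectorEnergy_le_pqgSingletEnergy _ _ _ hnk
  have h := hubbardRingTV_gap_sector_le_uniform hn t hU
  linarith

end Uniform

end Summit.Ventures.CertifiedQuantumChemistry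

end
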